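import Summits.QuantumFields.YangMills.Theorems.UnitScaleTiltProp8HalvingELDerivation
import HarnessLib

/-!
# Route `UnitScaleTilt`, crux K1 child «MinimiserStabilityRegPr» (stmt-QuantumFields-19200), registered stub V2′ `stub_halvingStep`
# (skeletons v8 5b4e846794b80374 / v10 `BirthV10`) — **THE TRACE-PAIRING JUNCTION (owner MAP #3, M3): ★w5-19200 g2's Euler–Lagrange condition in trace currency
# ⟹ the weak Euler–Lagrange equation per real reading** (the `hEL` of `HalvingELDerivation.sol158_of_weakEL`): if the chart field `A` and its current `W` are bondwise
# SELF-ADJOINT and, for every real test field `s` with `Qs = 0` and every self-adjoint matrix `E`,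
# `Re[(η²/2)Σ_p tr(Φ_p(A)Φ_p(s•E)) + η⁴Σ_b tr(W(b)·s(b)E)] = 0` — the conclusion of `FlatActionCritical.re_gradient_pairing_eq_zero_of_isMinOn_wilson` (p601073) at the
# directions `δ = s•E`, which stay in the self-adjoint competitor set — then `⟨∂s, ∂(φ∘A)⟩ + ⟨s, φ∘(2W)⟩ = 0` for EVERY `ℝ`-linear reading `φ` (lattice factor `η⁻¹`)

Cell `ym3-torus` (HUMAN RULING D-0037, YM ladder rung R3 — continuum SU(2) YM₃ on the torus is a RUNG, not the Clay problem), width seat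
`ym-ust-19200-w3` gen 3 (D-0149).  `--supports stmt-QuantumFields-19200 --as helper`; def-free, 0 sorry, standard axioms.

THE PRINT ([Balaban1985Variational] (99)–(100) p. 293, (127) p. 297): the Euler–Lagrange equation of `𝔊(A′) = ½⟨A′, ΔA′⟩ + V(A′)` on `{QA′ = B}` tested against all `δA′` with
`QδA′ = 0`.  THE TRICK (why self-adjoint test matrices suffice): the pairing is `Re tr(Z·E)` with the MATRIX CURRENT `Z = (η²/2)Σ_p Φ_p(s)Φ_p(A) + η⁴Σ_b s(b)W(b)`, which is
self-adjoint; testing with `E := Z` gives `tr(ZZᴴ) = 0`, hence `Z = 0` (`Matrix.trace_mul_conjTranspose_self_eq_zero_iff`), and `φ(Z) = 0` for every real-linear `φ` IS the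
weak E–L equation read through `φ`.

WHAT THIS FILE PROVES (no definition, no sorry; every `D : Domains P`, fine bonds of the Setup torus):
* `matrixCurrent_eq_zero_of_tracePairing` — the matrix current `Z(s)` vanishes for every real `s ∈ ker Q`;
* **`weakEL_of_tracePairing`** — the weak E–L equation per reading with current `2•W` and lattice factor `η⁻¹`;
* **`sol158_of_tracePairing`** (T³ carrier) — composed with `HalvingELDerivation.sol158_of_weakEL`: trace pairing on `ker Q` ∧ slice per reading ⟹
  `(A − H(QA)) + 𝒢(2•W) = 0` with P2's pinned `H`, `G̃` — the `hsol` of the (165)-A₁ row.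
HONEST SCOPE.  Finite-dimensional algebra; the trace-pairing hypothesis (criticality of the charted Wilson functional over `{QA′ = B}`, p. 297's gauge-invariance extension
included) and the slice are the assembler's (P5∕P1); the normalisations (`2•W`, `η⁴`) are displayed, not hidden.  NOT a claim about the crux, the rung, or the mass gap.

References: T. Bałaban, CMP **102** (1985) 277–309 [Balaban1985Variational] (99)–(100) p.293, (127)–(133) pp.297–298, (157)–(158) p.302.
-/

set_option autoImplicit false

noncomputable section

open scoped BigOperators InnerProductSpace Matrix Matrix.Norms.L2Operator ComplexOrder

namespace Summit.QuantumFields.YangMills.Theorems.HalvingELTracePairing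

open Literature.MathematicalPhysics.QuantumFieldTheory.Balaban1983to89
open Literature.MathematicalPhysics.QuantumFieldTheory.BalabanImbrieJaffe1984to88.BIJ85AxialPropagator411 (BondSpace PlaqSpace)
open B6SectADomainsV1 (Domains)
open B6SectAOperatorsV1 (BondIdx QE RE dsE dcE inner_eq_sum dcE_apply)
open LatticeFieldCalculus (curl bondAvgIter)
open T3ContinuumYM3Torus (T3Family)
open FlatCubeOpsText (IsFlatGt)
open FlatOpsLettersAssembly (flatH)
open HalvingELDerivation (sol158_of_weakEL)

/-! ## §1 The matrix current vanishes -/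

section Model

variable {P : Params} (D : Domains P)

/-- **THE MATRIX CURRENT VANISHES**: for bondwise self-adjoint `A`, `W`, a real `s` and `η`, if the trace pairing
`Re[(η²/2)Σ_p tr(Φ_p(A)Φ_p(s•E)) + η⁴Σ_b tr(W(b)·s(b)E)]` vanishes for every SELF-ADJOINT `E`, then the self-adjoint matrix
`Z = (η²/2)Σ_p Φ_p(s)Φ_p(A) + η⁴Σ_b s(b)W(b)` is `0` (test with `E := Z`: `tr(ZZᴴ) = 0`). [cite: Balaban1985Variational, (99)-(100) p.293, (127) p.297] -/
theorem matrixCurrent_eq_zero_of_tracePairing (η : ℝ) {A W : PBond P 0 → Matrix (Fin 2) (Fin 2) ℂ}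
    (hA : ∀ b, IsSelfAdjoint (A b)) (hW : ∀ b, IsSelfAdjoint (W b)) (s : PBond P 0 → ℝ)
    (hpair : ∀ E : Matrix (Fin 2) (Fin 2) ℂ, IsSelfAdjoint E →
      (((η : ℂ) ^ 2 / 2) * ∑ p : Plaq P 0, Matrix.trace ((A ⟨p.src, p.μ⟩ + A ⟨p.src.shift p.μ, p.ν⟩ - A ⟨p.src.shift p.ν, p.μ⟩ - A ⟨p.src, p.ν⟩) *
          (((s ⟨p.src, p.μ⟩ : ℝ) : ℂ) • E + ((s ⟨p.src.shift p.μ, p.ν⟩ : ℝ) : ℂ) • E - ((s ⟨p.src.shift p.ν, p.μ⟩ : ℝ) : ℂ) • E -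
            ((s ⟨p.src, p.ν⟩ : ℝ) : ℂ) • E)) +
        (η : ℂ) ^ 4 * ∑ b : PBond P 0, Matrix.trace (W b * (((s b : ℝ) : ℂ) • E))).re = 0) :
    (η ^ 2 / 2) • ∑ p : Plaq P 0, (s ⟨p.src, p.μ⟩ + s ⟨p.src.shift p.μ, p.ν⟩ - s ⟨p.src.shift p.ν, p.μ⟩ - s ⟨p.src, p.ν⟩) •
        (A ⟨p.src, p.μ⟩ + A ⟨p.src.shift p.μ, p.ν⟩ - A ⟨p.src.shift p.ν, p.μ⟩ - A ⟨p.src, p.ν⟩) +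
      (η ^ 4) • ∑ b : PBond P 0, s b • W b = 0 := by
  set Z : Matrix (Fin 2) (Fin 2) ℂ := (η ^ 2 / 2) • ∑ p : Plaq P 0, (s ⟨p.src, p.μ⟩ + s ⟨p.src.shift p.μ, p.ν⟩ - s ⟨p.src.shift p.ν, p.μ⟩ - s ⟨p.src, p.ν⟩) •
        (A ⟨p.src, p.μ⟩ + A ⟨p.src.shift p.μ, p.ν⟩ - A ⟨p.src.shift p.ν, p.μ⟩ - A ⟨p.src, p.ν⟩) +
      (η ^ 4) • ∑ b : PBond P 0, s b • W b with hZ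
  -- `Z` is self-adjoint
  have hZsa : IsSelfAdjoint Z := by
    refine IsSelfAdjoint.add (IsSelfAdjoint.smul (IsSelfAdjoint.all _) (isSelfAdjoint_sum _ fun p _ => ?_))
      (IsSelfAdjoint.smul (IsSelfAdjoint.all _) (isSelfAdjoint_sum _ fun b _ => IsSelfAdjoint.smul (IsSelfAdjoint.all _) (hW b)))
    exact IsSelfAdjoint.smul (IsSelfAdjoint.all _) (((hA _).add (hA _)).sub (hA _) |>.sub (hA _))
  -- the pairing is `Re tr(Z·E)`
  have hZE : ∀ E : Matrix (Fin 2) (Fin 2) ℂ,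
      (((η : ℂ) ^ 2 / 2) * ∑ p : Plaq P 0, Matrix.trace ((A ⟨p.src, p.μ⟩ + A ⟨p.src.shift p.μ, p.ν⟩ - A ⟨p.src.shift p.ν, p.μ⟩ - A ⟨p.src, p.ν⟩) *
          (((s ⟨p.src, p.μ⟩ : ℝ) : ℂ) • E + ((s ⟨p.src.shift p.μ, p.ν⟩ : ℝ) : ℂ) • E - ((s ⟨p.src.shift p.ν, p.μ⟩ : ℝ) : ℂ) • E -
            ((s ⟨p.src, p.ν⟩ : ℝ) : ℂ) • E)) +
        (η : ℂ) ^ 4 * ∑ b : PBond P 0, Matrix.trace (W b * (((s b : ℝ) : ℂ) • E))) = Matrix.trace (Z * E) := by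
    intro E
    have hcomb : ∀ p : Plaq P 0, ((s ⟨p.src, p.μ⟩ : ℝ) : ℂ) • E + ((s ⟨p.src.shift p.μ, p.ν⟩ : ℝ) : ℂ) • E - ((s ⟨p.src.shift p.ν, p.μ⟩ : ℝ) : ℂ) • E -
        ((s ⟨p.src, p.ν⟩ : ℝ) : ℂ) • E = (((s ⟨p.src, p.μ⟩ + s ⟨p.src.shift p.μ, p.ν⟩ - s ⟨p.src.shift p.ν, p.μ⟩ - s ⟨p.src, p.ν⟩ : ℝ)) : ℂ) • E := by
      intro p
      push_cast
      simp only [add_smul, sub_smul]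
    simp only [hcomb, hZ, Matrix.add_mul, Matrix.smul_mul, Finset.sum_mul, Matrix.trace_add, Matrix.trace_smul, Matrix.trace_sum, Matrix.mul_smul,
      ← Complex.coe_smul, smul_eq_mul, Finset.mul_sum]
    push_cast
    ring_nf
  -- test with `E := Z`
  have h0 := hpair Z hZsa
  rw [hZE] at h0
  have hZZ : Z * Z = Z * Zᴴ := by rw [← Matrix.star_eq_conjTranspose, hZsa.star_eq]
  rw [hZZ] at h0
  have him : (Matrix.trace (Z * Zᴴ)).im = 0 := by
    rw [← Complex.conj_eq_iff_im]
    have h := Matrix.trace_conjTranspose (Z * Zᴴ)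
    rw [Matrix.conjTranspose_mul, Matrix.conjTranspose_conjTranspose] at h
    rw [Complex.star_def] at h
    exact h.symm
  have htr : Matrix.trace (Z * Zᴴ) = 0 := Complex.ext h0 him
  exact Matrix.trace_mul_conjTranspose_self_eq_zero_iff.1 htr

/-- **THE WEAK EULER–LAGRANGE EQUATION PER READING FROM THE TRACE PAIRING**: for bondwise self-adjoint `A`, `W`, `η ≠ 0`: if the trace pairing vanishes for every real `s` with
`Qs = 0` and every self-adjoint `E`, then for EVERY `ℝ`-linear reading `φ` and every real `s` with `Qs = 0`:
`⟨∂s, ∂(φ∘A)⟩ + ⟨s, φ∘(2W)⟩ = 0` (lattice factor `η⁻¹`) — the `hEL` of `HalvingELDerivation.sol158_of_weakEL`. [cite: Balaban1985Variational, (99)-(100) p.293, (127) p.297] -/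
theorem weakEL_of_tracePairing {η : ℝ} (hη : η ≠ 0) {A W : PBond P 0 → Matrix (Fin 2) (Fin 2) ℂ}
    (hA : ∀ b, IsSelfAdjoint (A b)) (hW : ∀ b, IsSelfAdjoint (W b))
    (hpair : ∀ s : PBond P 0 → ℝ, QE D (WithLp.toLp 2 s) = 0 → ∀ E : Matrix (Fin 2) (Fin 2) ℂ, IsSelfAdjoint E →
      (((η : ℂ) ^ 2 / 2) * ∑ p : Plaq P 0, Matrix.trace ((A ⟨p.src, p.μ⟩ + A ⟨p.src.shift p.μ, p.ν⟩ - A ⟨p.src.shift p.ν, p.μ⟩ - A ⟨p.src, p.ν⟩) *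
          (((s ⟨p.src, p.μ⟩ : ℝ) : ℂ) • E + ((s ⟨p.src.shift p.μ, p.ν⟩ : ℝ) : ℂ) • E - ((s ⟨p.src.shift p.ν, p.μ⟩ : ℝ) : ℂ) • E -
            ((s ⟨p.src, p.ν⟩ : ℝ) : ℂ) • E)) +
        (η : ℂ) ^ 4 * ∑ b : PBond P 0, Matrix.trace (W b * (((s b : ℝ) : ℂ) • E))).re = 0) :
    ∀ (φ : Matrix (Fin 2) (Fin 2) ℂ →ₗ[ℝ] ℝ) (sE : BondSpace P), QE D sE = 0 →
      ⟪dcE η⁻¹ sE, dcE η⁻¹ (WithLp.toLp 2 (fun b => φ (A b)))⟫_ℝ + ⟪sE, WithLp.toLp 2 (fun b => φ ((2 : ℝ) • W b))⟫_ℝ = 0 := by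
  intro φ sE hsE
  set s : PBond P 0 → ℝ := WithLp.ofLp sE with hs
  have hsE' : QE D (WithLp.toLp 2 s) = 0 := by rw [hs, WithLp.toLp_ofLp]; exact hsE
  have hZ0 := congrArg φ (matrixCurrent_eq_zero_of_tracePairing η hA hW s (hpair s hsE'))
  rw [map_zero, map_add, map_smul, map_smul, map_sum, map_sum] at hZ0
  simp only [map_smul, smul_eq_mul] at hZ0
  -- the two inner products as sums
  have e1 : ⟪dcE η⁻¹ sE, dcE η⁻¹ (WithLp.toLp 2 (fun b => φ (A b)))⟫_ℝ =
      (η⁻¹) ^ 2 * ∑ p : Plaq P 0, (s ⟨p.src, p.μ⟩ + s ⟨p.src.shift p.μ, p.ν⟩ - s ⟨p.src.shift p.ν, p.μ⟩ - s ⟨p.src, p.ν⟩) *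
        φ (A ⟨p.src, p.μ⟩ + A ⟨p.src.shift p.μ, p.ν⟩ - A ⟨p.src.shift p.ν, p.μ⟩ - A ⟨p.src, p.ν⟩) := by
    rw [inner_eq_sum, Finset.mul_sum]
    refine Finset.sum_congr rfl fun p _ => ?_
    simp only [dcE_apply, curl, smul_eq_mul, map_add, map_sub, hs]
    ring
  have e2 : ⟪sE, WithLp.toLp 2 (fun b => φ ((2 : ℝ) • W b))⟫_ℝ = 2 * ∑ b : PBond P 0, s b * φ (W b) := by
    rw [inner_eq_sum, Finset.mul_sum]
    refine Finset.sum_congr rfl fun b _ => ?_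
    simp only [map_smul, smul_eq_mul, hs]
    ring
  rw [e1, e2]
  have key : (η⁻¹) ^ 2 * ∑ p : Plaq P 0, (s ⟨p.src, p.μ⟩ + s ⟨p.src.shift p.μ, p.ν⟩ - s ⟨p.src.shift p.ν, p.μ⟩ - s ⟨p.src, p.ν⟩) *
          φ (A ⟨p.src, p.μ⟩ + A ⟨p.src.shift p.μ, p.ν⟩ - A ⟨p.src.shift p.ν, p.μ⟩ - A ⟨p.src, p.ν⟩) + 2 * ∑ b : PBond P 0, s b * φ (W b) =
      (2 / η ^ 4) * (η ^ 2 / 2 * ∑ p : Plaq P 0, (s ⟨p.src, p.μ⟩ + s ⟨p.src.shift p.μ, p.ν⟩ - s ⟨p.src.shift p.ν, p.μ⟩ - s ⟨p.src, p.ν⟩) *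
          φ (A ⟨p.src, p.μ⟩ + A ⟨p.src.shift p.μ, p.ν⟩ - A ⟨p.src.shift p.ν, p.μ⟩ - A ⟨p.src, p.ν⟩) + η ^ 4 * ∑ b : PBond P 0, s b * φ (W b)) := by
    field_simp
  rw [key, hZ0, mul_zero]

end Model

/-! ## §2 At the T³ carrier: (158) from the trace pairing and the slice -/

section Carrier

variable {F : T3Family} {n K : ℕ}

/-- **(158) FROM ★w5's TRACE PAIRING AND THE SLICE** (`weakEL_of_tracePairing` ∘ `HalvingELDerivation.sol158_of_weakEL`): at the T³ carrier (`η = L^{−(K−n)}`, lattice factor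
`L^{K−n}`), for EVERY nested family `D` and P2's pinned `H` (`flatH`), `G̃` (`IsFlatGt`): if the bondwise self-adjoint chart field `A` and current `W` satisfy the trace pairing on
`ker Q` (self-adjoint test matrices) and every reading of `A` lies on the slice, then with `𝔄 = Σ_c (He_c)·(QA)(c)` and `𝒢 = Σ_{b′} (G̃e_{b′})·(2W(b′))`: `(A − 𝔄) + 𝒢 = 0` —
the `hsol` of the (165)-A₁ row with `A₁ := A − 𝔄` and current map `2W`. [cite: Balaban1985Variational, (127)-(133) pp.297-298, (157)-(158) p.302] -/
theorem sol158_of_tracePairing (D : Domains (F.P K)) {Gt : (PBond (F.P K) 0 → ℝ) →ₗ[ℝ] (PBond (F.P K) 0 → ℝ)} (hGt : IsFlatGt F n K D Gt)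
    {A W 𝔄 𝒢 : PBond (F.P K) 0 → Matrix (Fin 2) (Fin 2) ℂ} (hA : ∀ b, IsSelfAdjoint (A b)) (hW : ∀ b, IsSelfAdjoint (W b))
    (hpair : ∀ s : PBond (F.P K) 0 → ℝ, QE D (WithLp.toLp 2 s) = 0 → ∀ E : Matrix (Fin 2) (Fin 2) ℂ, IsSelfAdjoint E →
      ((((((F.L : ℝ)⁻¹) ^ (K - n) : ℝ) : ℂ) ^ 2 / 2) *
          ∑ p : Plaq (F.P K) 0, Matrix.trace ((A ⟨p.src, p.μ⟩ + A ⟨p.src.shift p.μ, p.ν⟩ - A ⟨p.src.shift p.ν, p.μ⟩ - A ⟨p.src, p.ν⟩) *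
            (((s ⟨p.src, p.μ⟩ : ℝ) : ℂ) • E + ((s ⟨p.src.shift p.μ, p.ν⟩ : ℝ) : ℂ) • E - ((s ⟨p.src.shift p.ν, p.μ⟩ : ℝ) : ℂ) • E -
              ((s ⟨p.src, p.ν⟩ : ℝ) : ℂ) • E)) +
        ((((F.L : ℝ)⁻¹) ^ (K - n) : ℝ) : ℂ) ^ 4 * ∑ b : PBond (F.P K) 0, Matrix.trace (W b * (((s b : ℝ) : ℂ) • E))).re = 0)
    (hslice : ∀ φ : Matrix (Fin 2) (Fin 2) ℂ →ₗ[ℝ] ℝ,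
      RE D ((F.L : ℝ) ^ (K - n)) (dsE ((F.L : ℝ) ^ (K - n)) (WithLp.toLp 2 (fun b => φ (A b)))) = 0)
    (h𝔄 : ∀ b, 𝔄 b = ∑ c, flatH F n K D (Pi.single c 1) b • bondAvgIter (c.1.1 : ℕ) A c.1.2)
    (h𝒢 : ∀ b, 𝒢 b = ∑ b', Gt (Pi.single b' 1) b • ((2 : ℝ) • W b')) :
    (A - 𝔄) + 𝒢 = 0 := by
  have hL0 : (0 : ℝ) < (F.L : ℝ) := by exact_mod_cast lt_trans zero_lt_one F.hL.2
  have hη : (((F.L : ℝ)⁻¹) ^ (K - n) : ℝ) ≠ 0 := by positivity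
  have hη' : ((((F.L : ℝ)⁻¹) ^ (K - n))⁻¹ : ℝ) = (F.L : ℝ) ^ (K - n) := by rw [inv_pow, inv_inv]
  have hEL := weakEL_of_tracePairing D hη hA hW hpair
  rw [hη'] at hEL
  exact sol158_of_weakEL D hGt (Wc := fun b => (2 : ℝ) • W b) hEL hslice h𝔄 h𝒢

end Carrier

end Summit.QuantumFields.YangMills.Theorems.HalvingELTracePairing

end
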